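import Mathlib
import Summits.ABC.ABC.Statement
import Literature.NumberTheory.DiophantineGeometry.GeneralizedFermatTwoPowerCoefficient
import HarnessLib

/-!
# The equal-exponent slices of the generic ω = 3 equations are empty (solo-blind seat, session 5)

For the generic equations `2^l + q^m = rⁿ` (shape A) and `p^l + q^m = 2ⁿ` (shape B) of the first open support we
decide the slices where the two odd bases carry the SAME exponent `m ≥ 3`:

* unconditionally when `2 ∣ m` or `3 ∣ m` (difference / sum of two squares or two cubes equal to a power of two);
* from Wiles (`FermatLastTheorem`, Mathlib's statement), Ribet 1997 (`ribet1997_twoPowerFermat`) and Darmon–Merel 1997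
  (`darmonMerel1997_denesEquation`) — named Literature facts used as hypotheses — when `m` has a prime factor `≥ 5`:
  writing `2^l = 2^b (2^a)^p` with `b = l mod p` lands in Fermat (`b = 0`), Dénes (`b = 1`) or Ribet (`2 ≤ b < p`).

* `shapeA_equal_exponent` : `q, r` odd coprime, `1 < q`, `3 ≤ m`, `2^l + q^m = r^m` ⇒ `False` (given the three facts).
* `shapeB_equal_exponent` : `p, q` odd coprime, `1 < p`, `3 ≤ m`, `p^m + q^m = 2^n` ⇒ `False` (given the three facts).
* `shapeA_equal_exponent_elem`, `shapeB_equal_exponent_elem` : the same unconditionally when `2 ∣ m ∨ 3 ∣ m`.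
-/

namespace Summit.ABC.ABC.Theorems

open Literature.NumberTheory.DiophantineGeometry

/-! ### Elementary slices -/

/-- `X³ - Y³` is never a power of two for odd `X, Y`. -/
private theorem cube_sub_cube {l X Y : ℕ} (hX : Odd X) (hY : Odd Y) (h : 2 ^ l + Y ^ 3 = X ^ 3) : False := by
  have hl : 1 ≤ 2 ^ l := Nat.one_le_two_pow
  have hlt : Y < X := by
    by_contra hle
    have : X ^ 3 ≤ Y ^ 3 := Nat.pow_le_pow_left (Nat.le_of_not_lt hle) 3
    omega
  obtain ⟨d, rfl⟩ : ∃ d, X = Y + d := ⟨X - Y, by omega⟩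
  have hd : 1 ≤ d := by omega
  set F := 3 * Y ^ 2 + 3 * Y * d + d ^ 2 with hF
  have hkey : 2 ^ l = d * F := by
    have : (Y + d) ^ 3 = Y ^ 3 + d * F := by rw [hF]; ring
    omega
  have hFdvd : F ∣ 2 ^ l := ⟨d, by rw [hkey, mul_comm]⟩
  obtain ⟨t, -, ht⟩ := (Nat.dvd_prime_pow Nat.prime_two).mp hFdvd
  have hdeven : Even d := by
    have : Even (Y + d - Y) := Nat.Odd.sub_odd hX hY
    simpa using this
  have hFodd : Odd F := by
    rw [hF]
    obtain ⟨u, hu⟩ := hY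
    obtain ⟨v, hv⟩ := hdeven
    subst hu; subst hv
    exact ⟨6 * u * u + 6 * u + 1 + 3 * (2 * u + 1) * v + 2 * v * v, by ring⟩
  have ht0 : t = 0 := by
    by_contra ht0
    have : 2 ∣ F := by rw [ht]; exact dvd_pow_self 2 ht0
    exact (Nat.not_even_iff_odd.mpr hFodd) (even_iff_two_dvd.mpr this)
  rw [ht0, pow_zero] at ht
  have hY1 : 1 ≤ Y := by obtain ⟨u, hu⟩ := hY; omega
  have : 3 ≤ F := by rw [hF]; nlinarith
  omega

/-- `X³ + Y³ = 2ⁿ` with `X, Y` odd forces `X = Y = 1`. -/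
private theorem cube_add_cube {n X Y : ℕ} (hX : Odd X) (hY : Odd Y) (h : X ^ 3 + Y ^ 3 = 2 ^ n) : X = 1 ∧ Y = 1 := by
  have hX1 : 1 ≤ X := by obtain ⟨u, hu⟩ := hX; omega
  have hY1 : 1 ≤ Y := by obtain ⟨u, hu⟩ := hY; omega
  have hle : X * Y ≤ X ^ 2 + Y ^ 2 := by nlinarith
  set G := X ^ 2 + Y ^ 2 - X * Y with hG
  have hkey : (X + Y) * G = 2 ^ n := by
    rw [← h, hG]
    zify [hle]
    ring
  have hGdvd : G ∣ 2 ^ n := ⟨X + Y, by rw [← hkey, mul_comm]⟩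
  obtain ⟨t, -, ht⟩ := (Nat.dvd_prime_pow Nat.prime_two).mp hGdvd
  have hGodd : G % 2 = 1 := by
    have h1 : X ^ 2 % 2 = 1 := Nat.odd_iff.mp hX.pow
    have h2 : Y ^ 2 % 2 = 1 := Nat.odd_iff.mp hY.pow
    have h3 : X * Y % 2 = 1 := Nat.odd_iff.mp (Nat.odd_mul.mpr ⟨hX, hY⟩)
    rw [hG]
    omega
  have ht0 : t = 0 := by
    by_contra ht0
    have : 2 ∣ G := by rw [ht]; exact dvd_pow_self 2 ht0
    omega
  rw [ht0, pow_zero] at ht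
  have hG1 : X ^ 2 + Y ^ 2 = X * Y + 1 := by omega
  constructor <;> nlinarith

/-- `X² - Y² = 2^l` with `X, Y` odd forces `X = Y + 2`. -/
private theorem sq_sub_sq {l X Y : ℕ} (hX : Odd X) (hY : Odd Y) (h : 2 ^ l + Y ^ 2 = X ^ 2) : X = Y + 2 := by
  have hl : 1 ≤ 2 ^ l := Nat.one_le_two_pow
  have hlt : Y < X := by
    by_contra hle
    have : X ^ 2 ≤ Y ^ 2 := Nat.pow_le_pow_left (Nat.le_of_not_lt hle) 2
    omega
  obtain ⟨d, rfl⟩ : ∃ d, X = Y + d := ⟨X - Y, by omega⟩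
  have hkey : 2 ^ l = d * (2 * Y + d) := by
    have : (Y + d) ^ 2 = Y ^ 2 + d * (2 * Y + d) := by ring
    omega
  have hddvd : d ∣ 2 ^ l := ⟨2 * Y + d, hkey⟩
  have hedvd : 2 * Y + d ∣ 2 ^ l := ⟨d, by rw [hkey, mul_comm]⟩
  obtain ⟨s, -, hs⟩ := (Nat.dvd_prime_pow Nat.prime_two).mp hddvd
  obtain ⟨t, -, ht⟩ := (Nat.dvd_prime_pow Nat.prime_two).mp hedvd
  have hY2 : Y % 2 = 1 := Nat.odd_iff.mp hY
  have hdeven : d % 2 = 0 := by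
    have := Nat.odd_iff.mp hX
    omega
  -- `s = 0` contradicts parity, `s ≥ 2` makes `Y` even
  rcases Nat.lt_or_ge s 2 with hs2 | hs2
  · interval_cases s
    · rw [pow_zero] at hs; omega
    · rw [pow_one] at hs; omega
  · exfalso
    have h4d : 4 ∣ d := by rw [hs]; exact (Nat.pow_dvd_pow 2 hs2 : 2 ^ 2 ∣ 2 ^ s)
    have ht2 : 2 ≤ t := by
      by_contra ht2
      have : 2 ^ t ≤ 2 ^ 1 := Nat.pow_le_pow_right (by norm_num) (by omega)
      omega
    have h4e : 4 ∣ 2 * Y + d := by rw [ht]; exact (Nat.pow_dvd_pow 2 ht2 : 2 ^ 2 ∣ 2 ^ t)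
    omega

/-- Two `k`-th powers (`k ≥ 2`) never differ by `2` (for a positive base). -/
private theorem pow_add_two_ne_pow {k q r : ℕ} (hk : 2 ≤ k) (hq : 1 ≤ q) (h : q ^ k + 2 = r ^ k) : False := by
  have hlt : q < r := by
    by_contra hle
    have : r ^ k ≤ q ^ k := Nat.pow_le_pow_left (Nat.le_of_not_lt hle) k
    omega
  obtain ⟨k', rfl⟩ : ∃ k', k = k' + 2 := ⟨k - 2, by omega⟩
  have h1 : q ^ k' ≤ r ^ k' := Nat.pow_le_pow_left hlt.le k'
  have h2 : 1 ≤ q ^ k' := Nat.one_le_pow _ _ hq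
  have h3 : q + 1 ≤ r := hlt
  rw [pow_add, pow_add] at h
  have h4 : q ^ k' * (q + 1) ^ 2 ≤ r ^ k' * r ^ 2 := Nat.mul_le_mul h1 (Nat.pow_le_pow_left h3 2)
  have h5 : q ^ k' * (q + 1) ^ 2 = q ^ k' * q ^ 2 + (2 * q + 1) * q ^ k' := by ring
  rw [h5] at h4
  have h6 : 3 ≤ (2 * q + 1) * q ^ k' := by nlinarith
  linarith

/-- `X² + Y² = 2ⁿ` with `X, Y` odd forces `X = Y = 1`. -/
private theorem sq_add_sq {n X Y : ℕ} (hX : Odd X) (hY : Odd Y) (h : X ^ 2 + Y ^ 2 = 2 ^ n) : X = 1 ∧ Y = 1 := by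
  have h1 : X ^ 2 % 4 = 1 := by
    obtain ⟨u, rfl⟩ := hX
    rw [show (2 * u + 1) ^ 2 = 4 * (u * u + u) + 1 by ring]
    omega
  have h2 : Y ^ 2 % 4 = 1 := by
    obtain ⟨u, rfl⟩ := hY
    rw [show (2 * u + 1) ^ 2 = 4 * (u * u + u) + 1 by ring]
    omega
  have hn : n < 2 := by
    by_contra hn
    have : 4 ∣ 2 ^ n := (Nat.pow_dvd_pow 2 (Nat.le_of_not_lt hn) : 2 ^ 2 ∣ 2 ^ n)
    omega
  have hX1 : 1 ≤ X := by obtain ⟨u, hu⟩ := hX; omega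
  have hY1 : 1 ≤ Y := by obtain ⟨u, hu⟩ := hY; omega
  interval_cases n
  · omega
  · constructor <;> nlinarith

/-- An odd number `≥ 3` not divisible by `3` has a prime factor `≥ 5`. -/
private theorem exists_prime_ge_five {m : ℕ} (hm : 3 ≤ m) (h2 : ¬ 2 ∣ m) (h3 : ¬ 3 ∣ m) :
    ∃ p, p.Prime ∧ p ∣ m ∧ 5 ≤ p := by
  refine ⟨m.minFac, Nat.minFac_prime (by omega), Nat.minFac_dvd m, ?_⟩
  have hp := Nat.minFac_prime (show m ≠ 1 by omega)
  have hp2 : m.minFac ≠ 2 := fun h => h2 (h ▸ Nat.minFac_dvd m)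
  have hp3 : m.minFac ≠ 3 := fun h => h3 (h ▸ Nat.minFac_dvd m)
  have hp4 : m.minFac ≠ 4 := fun h => by
    have := hp.eq_one_or_self_of_dvd 2 (by rw [h]; norm_num)
    omega
  have := hp.two_le
  omega

/-! ### Shape A: `2^l + q^m = r^m` -/

/-- **Shape A, equal exponents, elementary part.** `2 ∣ m` or `3 ∣ m`, `m ≥ 3`: no odd coprime `q > 1`, `r` with
`2^l + q^m = r^m`. -/
theorem shapeA_equal_exponent_elem {l m q r : ℕ} (hq : Odd q) (hr : Odd r) (hq1 : 1 < q) (hm : 3 ≤ m)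
    (h23 : 2 ∣ m ∨ 3 ∣ m) (h : 2 ^ l + q ^ m = r ^ m) : False := by
  rcases h23 with ⟨k, rfl⟩ | ⟨k, rfl⟩
  · rw [mul_comm 2 k, pow_mul, pow_mul] at h
    have hXY := sq_sub_sq (hr.pow) (hq.pow) h
    exact pow_add_two_ne_pow (k := k) (by omega) (by omega) hXY.symm
  · rw [mul_comm 3 k, pow_mul, pow_mul] at h
    exact cube_sub_cube (hr.pow) (hq.pow) h

/-- **Shape A, equal exponents.** Given Wiles, Ribet 1997 and Darmon–Merel 1997: for `m ≥ 3` there are no odd coprime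
`q > 1`, `r` with `2^l + q^m = r^m`. -/
theorem shapeA_equal_exponent (hFLT : FermatLastTheorem) (hR : ribet1997_twoPowerFermat)
    (hDM : darmonMerel1997_denesEquation) {l m q r : ℕ} (hq : Odd q) (hr : Odd r) (hcop : Nat.Coprime q r)
    (hq1 : 1 < q) (hm : 3 ≤ m) (h : 2 ^ l + q ^ m = r ^ m) : False := by
  by_cases h2 : 2 ∣ m
  · exact shapeA_equal_exponent_elem hq hr hq1 hm (Or.inl h2) h
  by_cases h3 : 3 ∣ m
  · exact shapeA_equal_exponent_elem hq hr hq1 hm (Or.inr h3) h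
  obtain ⟨p, hp, ⟨k, rfl⟩, hp5⟩ := exists_prime_ge_five hm h2 h3
  have hk : 1 ≤ k := by
    rcases k with _ | k
    · omega
    · omega
  rw [pow_mul', pow_mul'] at h
  set X := r ^ k with hXdef
  set Y := q ^ k with hYdef
  have hX : Odd X := hr.pow
  have hY : Odd Y := hq.pow
  have hY1 : 1 < Y := by
    rw [hYdef]
    calc 1 < q := hq1
      _ = q ^ 1 := (pow_one q).symm
      _ ≤ q ^ k := Nat.pow_le_pow_right (by omega) hk
  have hX0 : X ≠ 0 := by intro h0; rw [h0] at hX; exact (Nat.not_even_iff_odd.mpr hX) (by decide)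
  have hcopXY : Nat.Coprime Y X := Nat.Coprime.pow k k hcop
  have hpodd : Odd p := hp.odd_of_ne_two (by omega)
  -- `2^l = 2^b (2^a)^p`
  set a := l / p with hadef
  set b := l % p with hbdef
  have hbp : b < p := Nat.mod_lt _ hp.pos
  have hl : l = b + a * p := by rw [hadef, hbdef]; have := Nat.div_add_mod l p; linarith [this]
  -- integer coprimality data
  have cYX : IsCoprime (Y : ℤ) (-(X : ℤ)) := (Nat.isCoprime_iff_coprime.mpr hcopXY).neg_right
  have h2Y : Nat.Coprime (2 ^ a) Y :=
    Nat.Coprime.pow_left a ((Nat.Prime.coprime_iff_not_dvd Nat.prime_two).mpr fun h' =>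
      (Nat.not_even_iff_odd.mpr hY) (even_iff_two_dvd.mpr h'))
  have h2X : Nat.Coprime (2 ^ a) X :=
    Nat.Coprime.pow_left a ((Nat.Prime.coprime_iff_not_dvd Nat.prime_two).mpr fun h' =>
      (Nat.not_even_iff_odd.mpr hX) (even_iff_two_dvd.mpr h'))
  have cY2 : IsCoprime (Y : ℤ) ((2 : ℤ) ^ a) := by
    have := Nat.isCoprime_iff_coprime.mpr h2Y.symm
    push_cast at this
    exact this
  have c2X : IsCoprime ((2 : ℤ) ^ a) (-(X : ℤ)) := by
    have := (Nat.isCoprime_iff_coprime.mpr h2X).neg_right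
    push_cast at this
    exact this
  have hnz : (Y : ℤ) * (2 : ℤ) ^ a * (-(X : ℤ)) ≠ 0 := by
    have h1 : (Y : ℤ) ≠ 0 := by exact_mod_cast (show Y ≠ 0 by omega)
    have h2 : (X : ℤ) ≠ 0 := by exact_mod_cast hX0
    exact mul_ne_zero (mul_ne_zero h1 (pow_ne_zero _ two_ne_zero)) (neg_ne_zero.mpr h2)
  -- the equation in Ribet's shape
  have hEq : (Y : ℤ) ^ p + (2 : ℤ) ^ b * ((2 : ℤ) ^ a) ^ p + (-(X : ℤ)) ^ p = 0 := by
    rw [hpodd.neg_pow, ← pow_mul, ← pow_add, ← hl]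
    have : ((2 ^ l + Y ^ p : ℕ) : ℤ) = ((X ^ p : ℕ) : ℤ) := by rw [h]
    push_cast at this
    linear_combination this
  rcases Nat.lt_or_ge b 2 with hb2 | hb2
  · interval_cases b
    · -- Fermat
      have hF := hFLT p (by omega) (2 ^ a) Y X (pow_ne_zero _ two_ne_zero) (by omega) hX0
      apply hF
      rw [← pow_mul, ← h, hl, zero_add]
    · -- Dénes / Darmon–Merel
      rw [pow_one] at hEq
      rcases hDM p hp hp5 (Y : ℤ) ((2 : ℤ) ^ a) (-(X : ℤ)) hnz cY2 cYX c2X hEq with ⟨-, h2, -⟩ | ⟨h1, -, -⟩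
      · have : (0 : ℤ) < (2 : ℤ) ^ a := by positivity
        linarith
      · have : (0 : ℤ) ≤ (Y : ℤ) := by positivity
        linarith
  · -- Ribet
    exact hR p hp hp5 b hb2 hbp (Y : ℤ) ((2 : ℤ) ^ a) (-(X : ℤ)) hnz cY2 cYX c2X hEq

/-! ### Shape B: `p^m + q^m = 2ⁿ` -/

/-- **Shape B, equal exponents, elementary part.** `2 ∣ m` or `3 ∣ m`, `m ≥ 3`: no odd `p > 1`, `q` with
`p^m + q^m = 2ⁿ`. -/
theorem shapeB_equal_exponent_elem {m n p q : ℕ} (hp : Odd p) (hq : Odd q) (hp1 : 1 < p) (hm : 3 ≤ m)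
    (h23 : 2 ∣ m ∨ 3 ∣ m) (h : p ^ m + q ^ m = 2 ^ n) : False := by
  rcases h23 with ⟨k, rfl⟩ | ⟨k, rfl⟩
  · rw [mul_comm 2 k, pow_mul, pow_mul] at h
    have hk : k ≠ 0 := by omega
    have := (sq_add_sq (hp.pow) (hq.pow) h).1
    rw [Nat.pow_eq_one] at this
    omega
  · rw [mul_comm 3 k, pow_mul, pow_mul] at h
    have hk : k ≠ 0 := by omega
    have := (cube_add_cube (hp.pow) (hq.pow) h).1
    rw [Nat.pow_eq_one] at this
    omega

/-- **Shape B, equal exponents.** Given Wiles, Ribet 1997 and Darmon–Merel 1997: for `m ≥ 3` there are no odd coprime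
`p > 1`, `q` with `p^m + q^m = 2ⁿ`. -/
theorem shapeB_equal_exponent (hFLT : FermatLastTheorem) (hR : ribet1997_twoPowerFermat)
    (hDM : darmonMerel1997_denesEquation) {m n p q : ℕ} (hp : Odd p) (hq : Odd q) (hcop : Nat.Coprime p q)
    (hp1 : 1 < p) (hm : 3 ≤ m) (h : p ^ m + q ^ m = 2 ^ n) : False := by
  by_cases h2 : 2 ∣ m
  · exact shapeB_equal_exponent_elem hp hq hp1 hm (Or.inl h2) h
  by_cases h3 : 3 ∣ m
  · exact shapeB_equal_exponent_elem hp hq hp1 hm (Or.inr h3) h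
  obtain ⟨P, hP, ⟨k, rfl⟩, hP5⟩ := exists_prime_ge_five hm h2 h3
  have hk : 1 ≤ k := by
    rcases k with _ | k
    · omega
    · omega
  rw [pow_mul', pow_mul'] at h
  set X := p ^ k with hXdef
  set Y := q ^ k with hYdef
  have hX : Odd X := hp.pow
  have hY : Odd Y := hq.pow
  have hX1 : 1 < X := by
    rw [hXdef]
    calc 1 < p := hp1
      _ = p ^ 1 := (pow_one p).symm
      _ ≤ p ^ k := Nat.pow_le_pow_right (by omega) hk
  have hY0 : Y ≠ 0 := by intro h0; rw [h0] at hY; exact (Nat.not_even_iff_odd.mpr hY) (by decide)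
  have hcopXY : Nat.Coprime X Y := Nat.Coprime.pow k k hcop
  have hPodd : Odd P := hP.odd_of_ne_two (by omega)
  set a := n / P with hadef
  set b := n % P with hbdef
  have hbP : b < P := Nat.mod_lt _ hP.pos
  have hn : n = b + a * P := by rw [hadef, hbdef]; have := Nat.div_add_mod n P; linarith [this]
  have cXY : IsCoprime (X : ℤ) (Y : ℤ) := Nat.isCoprime_iff_coprime.mpr hcopXY
  have h2X : Nat.Coprime X (2 ^ a) :=
    Nat.Coprime.pow_right a ((Nat.Prime.coprime_iff_not_dvd Nat.prime_two).mpr fun h' =>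
      (Nat.not_even_iff_odd.mpr hX) (even_iff_two_dvd.mpr h')).symm
  have h2Y : Nat.Coprime (2 ^ a) Y :=
    Nat.Coprime.pow_left a ((Nat.Prime.coprime_iff_not_dvd Nat.prime_two).mpr fun h' =>
      (Nat.not_even_iff_odd.mpr hY) (even_iff_two_dvd.mpr h'))
  have cX2 : IsCoprime (X : ℤ) (-((2 : ℤ) ^ a)) := by
    have := (Nat.isCoprime_iff_coprime.mpr h2X).neg_right
    push_cast at this
    exact this
  have c2Y : IsCoprime (-((2 : ℤ) ^ a)) (Y : ℤ) := by
    have := (Nat.isCoprime_iff_coprime.mpr h2Y).neg_left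
    push_cast at this
    exact this
  have hnz : (X : ℤ) * (-((2 : ℤ) ^ a)) * (Y : ℤ) ≠ 0 := by
    have h1 : (X : ℤ) ≠ 0 := by exact_mod_cast (show X ≠ 0 by omega)
    have h2 : (Y : ℤ) ≠ 0 := by exact_mod_cast hY0
    exact mul_ne_zero (mul_ne_zero h1 (neg_ne_zero.mpr (pow_ne_zero _ two_ne_zero))) h2
  have hEq : (X : ℤ) ^ P + (2 : ℤ) ^ b * (-((2 : ℤ) ^ a)) ^ P + (Y : ℤ) ^ P = 0 := by
    rw [hPodd.neg_pow, ← pow_mul, mul_neg, ← pow_add, ← hn]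
    have : ((X ^ P + Y ^ P : ℕ) : ℤ) = ((2 ^ n : ℕ) : ℤ) := by rw [h]
    push_cast at this
    linear_combination this
  rcases Nat.lt_or_ge b 2 with hb2 | hb2
  · interval_cases b
    · -- Fermat
      have hF := hFLT P (by omega) X Y (2 ^ a) (by omega) hY0 (pow_ne_zero _ two_ne_zero)
      apply hF
      rw [h, hn, zero_add, pow_mul]
    · -- Dénes / Darmon–Merel
      rw [pow_one] at hEq
      rcases hDM P hP hP5 (X : ℤ) (-((2 : ℤ) ^ a)) (Y : ℤ) hnz cX2 cXY c2Y hEq with ⟨h1, -, -⟩ | ⟨h1, -, -⟩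
      · have : (1 : ℤ) < (X : ℤ) := by exact_mod_cast hX1
        linarith
      · have : (0 : ℤ) ≤ (X : ℤ) := by positivity
        linarith
  · -- Ribet
    exact hR P hP hP5 b hb2 hbP (X : ℤ) (-((2 : ℤ) ^ a)) (Y : ℤ) hnz cX2 cXY c2Y hEq

end Summit.ABC.ABC.Theorems
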